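import Summits.ResolutionOfSingularities.ResolutionOfSingularities.Theorems.FrobeniusClosingSteerArithTransportWords
import HarnessLib

/-!
# Crux `Steer` (stmt-ResolutionOfSingularities-16345), chain W4.1, β-leaf K-β0(b) — the SEVENTH visit word (S-BB) «the odd divisor of a
# B-stage SURVIVES a non-return visit as its quotient» (tri-1 D·S4), needed by the visit induction `arithTransport_of_words`
# (res-L0-w41-plan-1 RULING 299(b); seat res-L0-w41-stub-3 g8; for res-L0-w41-strat-2 g4 / res-L0-w41-tri-1 to audit)

OURS (campaign `res-hironaka`, rung L ★L-G4, slot W4.1). A SIGNATURE (one `def … : Prop`, no proof); candidate, not a fact; nothing here is a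
statement of H. Hironaka's manuscript [Hironaka2017] (status: under review). AI-written; AI review is weaker than expert review.

WHY A SEVENTH WORD. res-L0-w41-strat-2's six words (`…ArithTransportWords`: (F-AB), (F-BB), (T-R), (P-AB), (P-BB), (P-BA)) transport the cone
shape across one visit pair and pull anisotropy back, but they do not TYPE the landing stage of a `B → B` visit: leaving a B-stage `j` (odd
divisor `x`) along an exceptional parameter `u` with `v x < v u`, the pull-back (P-BB) wants the anisotropic B-shape at `j′` ALONG `x/u`, which
the induction hypothesis at `j′` supplies only for an ODD DIVISOR of the B-stage `j′` (`IsBStageAt … j′ (x/u)`). That `x/u` is one is tri-1's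
D·S4 (`Words.VisitLawAt` clause 5, direction →): the word below. It also closes the case table: a B-stage with `v x < v u` is never followed by
an A-stage (the landing stage has the odd divisor `x/u`, so — hS1b — cleaned order `d + 1`), so (F-BB)/(P-BB) always apply there, and the return
`v x = v u` (then `x` is itself exceptional) is (T-R)/(P-BA).
-/

-- `Summit.<S>.<S>.…` duplicates the summit name by design (single-problem summit).
set_option linter.dupNamespace false

open IsLocalRing
open Literature.AlgebraicGeometry.Resolution
open Summit.ResolutionOfSingularities.ResolutionOfSingularities.Theorems.SwitchingDichotomy.Words

namespace Summit.ResolutionOfSingularities.ResolutionOfSingularities.Theorems.SwitchingDichotomy.ArithTransport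

/-- **(S-BB) · `OddSatelliteSurvivesTwoN`** — SATELLITE TYPING, B → B (tri-1 D·S4 = `Words.VisitLawAt` clause 5, direction →, for THE odd
divisor of a B-stage; binders = those of (F-BB) without the cone and without the landing cleaned order): at a visit pair `(j, j′)` (only
`u`-strips strictly between, N4's height-one clause at `j′`) leaving a B-STAGE `j` (odd divisor `x`, cleaned order `d + 1`) with exceptional
parameter `u` of LARGER value than `x`, the quotient `x / u` is an ODD DIVISOR at `j′`. Reason: `v x < v u` makes `x, u` independent modulo
`𝔪_j²`, so `(u, x′ := x/u)` is part of a regular system of parameters of `R_{j′} = R_{j+1}` (`x′ ∈ 𝔪_{j′}` as `v x′ < 1`); writing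
`f_j = η² + x·G` and the visit law `f′·u^(d+1)·W² = f_j − G′² = (η − G′)² + u·x′·G` (characteristic `2`), modulo the prime `x′` one has
`f′·u^(2e)·W² ≡ (η − G′)²` in the regular domain `R_{j′}/(x′)` in which `u` is prime, so `u^e ∣ η − G′` there and `f′ ≡ □ (mod x′)`: the clord
along `x′` is `≥ 1`; it is `≤ 1` by (δ) (`VisitLawDelta.clord_le_one_of_noSingularHeightOne` from the height-one clause). Why it might fail:
only through a mis-typed side condition (the computation is the standard satellite chart). OURS. (folklore) -/
def OddSatelliteSurvivesTwoN : Prop :=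
  ∀ (K : Type) [Field K] [CharP K 2] (O : ValuationSubring K)
    (R : ℕ → Subring K) (P : (i : ℕ) → Ideal (R i)) (t : K) (s : ℕ → K),
    IsSteeredRun O R P t 2 s → SubringDominates (R 0) O.toSubring →
    (∀ i, IsRegularLocalRing (R i)) → (∀ i, ringKrullDim (R i) = (4 : ℕ)) →
    ∀ (j j' : ℕ) (x u : K) (d : ℕ), Odd d → 3 ≤ d → IsVisitPair R P j j' → IsExcParamAlong O (R j) (P j) u →
      (∀ l, j < l → l < j' → ∃ hu : u ∈ R l, P l = Ideal.span {(⟨u, hu⟩ : R l)}) →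
      (∀ (hs' : s j' ^ 2 ∈ R j') (Q : Ideal (R j')) [Q.IsPrime], Q.height = 1 →
        ¬ SigmaTopLegality.IsSingPrime (R j') 2 ⟨s j' ^ 2, hs'⟩ Q) →
      IsBStageAt R P s 2 j x → HasCleanedOrderAt R s 2 j (d + 1) →
      O.valuation x < O.valuation u →
      IsOddDivisorAt R s 2 j' (x / u)

end Summit.ResolutionOfSingularities.ResolutionOfSingularities.Theorems.SwitchingDichotomy.ArithTransport
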